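import Literature.Computability.Complexity.BPPTruthTableClosure
import Literature.Computability.Complexity.AdaptivePrograms
import Literature.Computability.Complexity.PRelAdaptiveForm
import Literature.Computability.Complexity.OracleCompositionMachine
import Literature.Computability.Complexity.PolyTimeCountable
import Literature.Computability.Complexity.PromiseCookMachine
import Literature.Computability.Complexity.OracleBPP
import Literature.Computability.QuantumComplexity.PromiseClassesRel
import Literature.Computability.QuantumComplexity.RandomOracleIndependence
import Literature.Computability.QuantumComplexity.OracleSeparationBQPPH
import Mathlib.MeasureTheory.OuterMeasure.BorelCantelli
import HarnessLib

/-!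
# Bennett–Gill for promise problems: `PromiseBPP^A ⊆ promiseLift (P^A)` for almost every `A`

Reproduction (trunk `Literature/Computability/Complexity`; solo seat
`solo-QuantumAdvantage-informed`, session 7) of the promise-problem form of

* C. H. Bennett, J. Gill, *Relative to a random oracle `A`, `P^A ≠ NP^A ≠ co-NP^A` with
  probability 1*, SIAM J. Comput. 10 (1981) 96–113, Thm. 5 (`P^A = BPP^A` with probability 1)
  [BennettGill1981] (not held: acq-00719; the argument is read in the type-2 form of
  R. V. Book, H. Vollmer, K. W. Wagner, *On type-2 probabilistic quantifiers*, ICALP 1996,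
  LNCS 1099, §4 Thm. 3, p. 374–375 [BookVollmerWagner1996], exactly as in the sibling file
  `BPPSubsetAlmostP.lean` which proves the language case `BPP ⊆ ALMOST-P`);
* with the error reduction of S. Arora, B. Barak, *Computational Complexity*, CUP 2009,
  Thm. 7.10 / §7.4.1 [AroraBarak2009] in the tree's exponential form
  (`PromiseBPPAmplificationExp.lean`), and promise problems after O. Goldreich, *On promise
  problems: a survey*, LNCS 3895 (2006), Def. 1.2 [Goldreich2006].

**What is reproduced.** For the relativized promise class `PromiseBPP'Rel O` of
`QuantumComplexity/PromiseClassesRel.lean` (a witness language `L' ∈ P^O` and a coin polynomial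
`p`, acceptance probability `≥ 2/3` on YES-instances and `≤ 1/3` on NO-instances, nothing
promised elsewhere) and the random oracle `randomOracleMeasure`:

  `promiseBPP'Rel_subset_promiseLift_PRel_ae :`
  `  ∀ᵐ A ∂randomOracleMeasure, PromiseBPP'Rel (Oracle.ofLanguage A) ⊆ promiseLift (PRel (Oracle.ofLanguage A))`,

i.e. relative to a random oracle, with probability `1`, **every promise problem of
`promise-BPP^A` has a solution language in `P^A`**. The language case does not give this
formally (a promise problem need not extend to a `BPP^A` language); the proof is Bennett–Gill's,
run promise-problem-wise:

1. (`PromiseAlmostP.canon`, `exists_canon_of_mem`) Every problem of `PromiseBPP'Rel O` is a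
   sub-problem of the *canonical* problem of its witness `(L', p)` — YES `= {x | Pr ≥ 2/3}`,
   NO `= {x | Pr[reject] ≥ 2/3}` — and `promiseLift` is monotone under sub-problems, so it
   suffices to solve the countably many canonical problems. The witnesses `L' ∈ P^A` are put in
   the adaptive normal form `adLang (qryFn M) q (haltLang M) A` of `PRelAdaptiveForm.lean`
   (one *total* description per machine, valid for every oracle), so the index set is
   `{poly-time oracle machines} × {budgets q} × {coin polynomials p}` — countable.
2. (`PromiseAlmostP.dec`, `dec_mem_PRel`) *The solver.* On input `x` of length `n` the `P^A`
   machine reads `m(n) = coins p X (n)` coin bits off the oracle at the fresh positions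
   `⟨⟨x, 1^{B(n)}⟩, 1ⁱ⟩`, `i < m(n)`, all *longer* than every string the votes can consult
   (`B = bnd`), and runs the Chernoff amplifier `PromiseAmp.ampLang` of the vote language with
   these coins. It is a `P^A` machine because every stage is an *adaptive-query presentation*
   over `A` (`AdaptivePrograms.lean`): the vote oracle (`adPres_ofLanguage_adLang`), the
   amplifier re-read stage by stage (`adPres_ofLanguage_ampLang`), the coin reader
   (`adPres_coinFn`).
3. (`measure_errEvent_le`) Under the random oracle, conditionally on the bits of length `≤ B(n)`
   (which fix the votes, hence the promise and the amplifier's verdict table), the window bits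
   are independent fair coins (`measure_inter_le_of_window` of `RandomOracleIndependence.lean`),
   so the solver violates the promise on `x` with probability `≤ e^{-(n+1)}`
   (`uniformProb_ampLang_compl_le_exp`, `uniformProb_ampLang_le_exp`).
4. (`ae_eventually_not_mem`) `∑ₙ 2ⁿ e^{-(n+1)} < ∞` and Borel–Cantelli; (`ae_canon_mem_promiseLift`)
   patch the finitely many short inputs (`mem_PRel_of_eqOn_le`: `P^A` is invariant under finite
   variations); (`promiseBPP'Rel_subset_promiseLift_PRel_ae`) intersect the countably many
   probability-one events (`ae_all_iff`).

Corollary `promiseBPP'Rel_subset_promiseLift_BPPRel_ae`: the same with `BPP^A` in place of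
`P^A` (`PRel ⊆ BPPRel`).

## References

* [BennettGill1981] Thm. 5; [BookVollmerWagner1996] §3 (p. 373), §4 Thm. 3 and (1) (p. 374–375),
  read via `lit read book:editor1996-automata-languages-programming --pages 409-420`.
* [AroraBarak2009] Thm. 7.10, §7.4.1 (error reduction), §3.4 (oracle machines).
* [Goldreich2006] Def. 1.2 (promise problems and their solutions).
* [LadnerLynchSelman1975] §3 (truth-table / adaptive oracle access).
* Mathlib: `MeasureTheory.ae_eventually_notMem`, `MeasureTheory.ae_all_iff`,
  `ENNReal.tsum_geometric`.
-/

noncomputable section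

namespace Literature.Computability.Complexity

open _root_.MeasureTheory QuantumComplexity _root_.Computability OracleCompose Filter Finset
  Polynomial PRelSigma Brick Plumb AdQuery
open scoped ENNReal Classical

namespace PromiseAlmostP

/-! ### Step 1: canonical promise problems -/

/-- The YES-set of the canonical problem of a witness `(L, p)`: acceptance probability `≥ 2/3`.
[cite: Goldreich2006, Def. 1.2] -/
def yesSet (L : Language Bool) (p : Polynomial ℕ) : Language Bool :=
  {x | 2 / 3 ≤ uniformProb (p.eval x.length) {y : List Bool | boolPair x y ∈ L}}

/-- The NO-set of the canonical problem of a witness `(L, p)`: rejection probability `≥ 2/3`.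
[cite: Goldreich2006, Def. 1.2] -/
def noSet (L : Language Bool) (p : Polynomial ℕ) : Language Bool :=
  {x | 2 / 3 ≤ uniformProb (p.eval x.length) {y : List Bool | boolPair x y ∉ L}}

/-- The canonical promise problem of a witness `(L, p)`. [cite: Goldreich2006, Def. 1.2] -/
def canon (L : Language Bool) (p : Polynomial ℕ) : PromiseProblem := ⟨yesSet L p, noSet L p⟩

/-- The canonical problem is a promise problem: YES and NO are disjoint. [folklore] -/
theorem not_mem_noSet_of_mem_yesSet {L : Language Bool} {p : Polynomial ℕ} {x : List Bool}
    (hx : x ∈ yesSet L p) : x ∉ noSet L p := by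
  intro hn
  have h1 : (2 : ℝ) / 3 ≤ uniformProb (p.eval x.length) {y : List Bool | boolPair x y ∈ L} := hx
  have h2 : (2 : ℝ) / 3 ≤ uniformProb (p.eval x.length) {y : List Bool | boolPair x y ∉ L} := hn
  have hc : {y : List Bool | boolPair x y ∉ L} = {y : List Bool | boolPair x y ∈ L}ᶜ := rfl
  rw [hc, uniformProb_compl] at h2
  linarith

/-- Every problem of `PromiseBPP'Rel O` is a sub-problem of the canonical problem of its
witness. [cite: Goldreich2006, Def. 1.2] -/
theorem exists_canon_of_mem {O : Oracle} {T : PromiseProblem} (hT : T ∈ PromiseBPP'Rel O) :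
    ∃ L ∈ PRel O, ∃ p : Polynomial ℕ, T.yes ≤ yesSet L p ∧ T.no ≤ noSet L p := by
  obtain ⟨L, hL, p, hyes, hno⟩ := hT
  exact ⟨L, hL, p, fun x hx => hyes x hx, fun x hx => hno x hx⟩

/-- `promiseLift` is monotone under sub-problems. [cite: Goldreich2006, Def. 1.2] -/
theorem mem_promiseLift_of_subset {C : Set (Language Bool)} {T T' : PromiseProblem}
    (hyes : T.yes ≤ T'.yes) (hno : T.no ≤ T'.no) (h : T' ∈ promiseLift C) :
    T ∈ promiseLift C := by
  obtain ⟨L, hL, hy, hn⟩ := h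
  exact ⟨L, hL, le_trans hyes hy, le_trans hno hn⟩

/-! ### Step 2a: adaptive-query presentations of the vote oracle and of the amplifier -/

/-- **The vote oracle is presented.** The oracle of the adaptive language `adLang Q q D A`
(`Q ∈ FP`, `D ∈ P`) is an adaptive-query presentation over `A`: queries `Q`, budget `q`,
post-processing `[· ∈ D]`. [cite: LadnerLynchSelman1975, §3] -/
theorem adPres_ofLanguage_adLang {A : Language Bool} {Q : List Bool → List Bool} (hQ : Q ∈ FP)
    (q : Polynomial ℕ) {D : Language Bool} (hD : D ∈ Classes.P) :
    AdPres A (Oracle.ofLanguage (adLang Q q D A)) :=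
  ⟨Q, Oracle.ofLanguage D, q, hQ, (indicatorFn_mem_FP hD : Oracle.ofLanguage D ∈ FP), fun x => by
    rw [ofLanguage_eq_singleton, ofLanguage_eq_singleton, boolIndicator_congr_of_iff mem_adLang_iff]⟩

/-- **The amplifier over a presented vote oracle is presented.** Re-reading the stages of
`PromiseAmp.ampLang` (vote, counter update, round, iteration, initial layout, final test) as
adaptive-query presentations over `A` (`AdaptivePrograms.lean`).
[cite: AroraBarak2009, §7.4.1 with §3.4] -/
theorem adPres_ofLanguage_ampLang {A L' : Language Bool} (hL' : AdPres A (Oracle.ofLanguage L'))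
    (p r : Polynomial ℕ) : AdPres A (Oracle.ofLanguage (PromiseAmp.ampLang L' p r)) := by
  have hvote : AdPres A (PromiseAmp.voteW L' p) := by
    have he : PromiseAmp.voteW L' p =
        Oracle.ofLanguage L' ∘ (truncSndFn p ∘ pairFn PromiseAmp.xW PromiseAmp.cW) :=
      funext fun w => by
        simp only [PromiseAmp.voteW, Function.comp_apply, ofLanguage_eq_singleton]
        cases L'.boolIndicator _ <;> rfl
    rw [he]
    exact hL'.comp_FP (comp_mem_FP (truncSndFn_mem_FP p)
      (pairFn_mem_FP PromiseAmp.xW_mem_FP PromiseAmp.cW_mem_FP))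
  have hdNew : AdPres A (PromiseAmp.dNew L' p) :=
    hvote.ite (AdPres.of_mem_FP (comp_mem_FP tail_mem_FP (comp_mem_FP tail_mem_FP PromiseAmp.dW_mem_FP)))
      (AdPres.of_mem_FP PromiseAmp.dW_mem_FP)
  have hround : AdPres A (PromiseAmp.roundFn L' p) := by
    have he : PromiseAmp.roundFn L' p =
        fanoutFn PromiseAmp.xW (fanoutFn (PromiseAmp.dNew L' p) (PromiseAmp.restW p)) :=
      funext fun w => by simp only [PromiseAmp.roundFn, pairFn_apply, fanoutFn_apply]
    rw [he]
    exact (AdPres.of_mem_FP PromiseAmp.xW_mem_FP).fanout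
      (hdNew.fanout (AdPres.of_mem_FP (PromiseAmp.restW_mem_FP p)))
  have hiter : AdPres A (PromiseAmp.iterFn L' p r) :=
    hround.iterate 4 (PromiseAmp.length_roundFn_le p) (PromiseAmp.votes r)
  have h : AdPres A
      (Oracle.ofLanguage IsNil ∘ ((PromiseAmp.dW ∘ PromiseAmp.iterFn L' p r) ∘ PromiseAmp.initW r)) :=
    ((hiter.FP_comp PromiseAmp.dW_mem_FP).comp_FP (PromiseAmp.initW_mem_FP r)).FP_comp
      (indicatorFn_mem_FP IsNil_mem_P : Oracle.ofLanguage IsNil ∈ FP)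
  have he : Oracle.ofLanguage (PromiseAmp.ampLang L' p r) =
      Oracle.ofLanguage IsNil ∘ ((PromiseAmp.dW ∘ PromiseAmp.iterFn L' p r) ∘ PromiseAmp.initW r) :=
    funext fun w => by
      rw [Function.comp_apply, ofLanguage_eq_singleton, ofLanguage_eq_singleton]
      exact congrArg (fun b => [b]) (boolIndicator_congr_of_iff Iff.rfl)
  rw [he]
  exact h

/-! ### Step 2b: the solver and its `P^A` machine -/

section Solver

variable (Q : List Bool → List Bool) (q s : Polynomial ℕ) (D : Language Bool) (p : Polynomial ℕ)

/-- The reach bound `B(n) = s(2(2n+2+p(n)) + 2 + q(2n+2+p(n)))`: if the queries `Q` have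
output length `≤ s`, every string consulted by a vote `⟨x, u⟩`, `|u| ≤ p(|x|)`, has length
`≤ B(|x|)`. [folklore] -/
def bnd : Polynomial ℕ := (s.comp (2 * X + 2 + q)).comp (2 * X + 2 + p)

/-- The value of the reach bound. [folklore] -/
theorem bnd_eval (n : ℕ) : (bnd q s p).eval n =
    s.eval (2 * (2 * n + 2 + p.eval n) + 2 + q.eval (2 * n + 2 + p.eval n)) := by
  simp [bnd, eval_comp]

/-- The padded instance `⟨x, 1^{B(|x|)}⟩` (prefix of the coin queries). [folklore] -/
def padFn : List Bool → List Bool := fanoutFn (fun w => w) (polyFn (bnd q s p))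

/-- Value of the padded instance. [folklore] -/
theorem padFn_apply (x : List Bool) :
    padFn q s p x = boolPair x (List.replicate ((bnd q s p).eval x.length) true) := by
  simp [padFn]

/-- The padding is in `FP`. [folklore] -/
theorem padFn_mem_FP : padFn q s p ∈ FP :=
  fanoutFn_mem_FP (PolyTimeComputable.id _) (polyFn_mem_FP _)

/-- Every coin query `⟨⟨x, 1^{B(|x|)}⟩, 1ⁱ⟩` is longer than the reach bound `B(|x|)`.
[folklore] -/
theorem bnd_lt_length_window (x : List Bool) (i : ℕ) :
    (bnd q s p).eval x.length < (boolPair (padFn q s p x) (List.replicate i true)).length := by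
  rw [length_boolPair, padFn_apply, length_boolPair, List.length_replicate, List.length_replicate]
  omega

/-- The coin string of input `x` read off the oracle `A`: the bits of `A` at the coin queries
`⟨⟨x, 1^{B(|x|)}⟩, 1ⁱ⟩`, `i < coins p X (|x|)`. [cite: BookVollmerWagner1996, §3 (p. 373)] -/
def coinStr (A : Language Bool) (x : List Bool) : List Bool :=
  ttBits id A (padFn q s p x) ((PromiseAmp.coins p X).eval x.length)

/-- **The solver** of the canonical problem of the vote language `adLang Q q D A`: run the
Chernoff amplifier `ampLang _ p X` on the coins read off the oracle.
[cite: BookVollmerWagner1996, §4 Thm. 3 (p. 374)] -/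
def dec (A : Language Bool) : Language Bool :=
  {x | boolPair x (coinStr q s p A x) ∈ PromiseAmp.ampLang (adLang Q q D A) p X}

/-- The error predicate of input `x` with explicit coins `c`: the promise of the canonical
problem holds at `x` and the amplifier's verdict on `⟨x, c⟩` violates it. [folklore] -/
def errWith (A : Language Bool) (x c : List Bool) : Prop :=
  (x ∈ yesSet (adLang Q q D A) p ∧ boolPair x c ∉ PromiseAmp.ampLang (adLang Q q D A) p X) ∨
    (x ∈ noSet (adLang Q q D A) p ∧ boolPair x c ∈ PromiseAmp.ampLang (adLang Q q D A) p X)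

/-- The error event of input `x`: the oracles `A` for which the promise of the canonical problem
holds at `x` and the solver violates it. [cite: BookVollmerWagner1996, §4 Thm. 3 (p. 374)] -/
def errEvent (x : List Bool) : Set (Set (List Bool)) :=
  {A | errWith Q q D p A x (coinStr q s p A x)}

/-- Unfolding the error event. [folklore] -/
theorem mem_errEvent_iff {A : Language Bool} {x : List Bool} :
    A ∈ errEvent Q q s D p x ↔
      (x ∈ yesSet (adLang Q q D A) p ∧ x ∉ dec Q q s D p A) ∨
        (x ∈ noSet (adLang Q q D A) p ∧ x ∈ dec Q q s D p A) :=
  Iff.rfl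

/-- The query generator of the coin reader: on `⟨x, bits⟩` ask coin query number `|bits|`.
[folklore] -/
def coinQry : List Bool → List Bool := fanoutFn (padFn q s p ∘ fstF) (polyFn X ∘ sndF)

/-- The coin reader's query generator is in `FP`. [folklore] -/
theorem coinQry_mem_FP : coinQry q s p ∈ FP :=
  fanoutFn_mem_FP (comp_mem_FP (padFn_mem_FP q s p) fstF_mem_FP)
    (comp_mem_FP (polyFn_mem_FP X) sndF_mem_FP)

/-- Value of the coin reader's query generator. [folklore] -/
theorem coinQry_boolPair (x bits : List Bool) :
    coinQry q s p (boolPair x bits) = boolPair (padFn q s p x) (List.replicate bits.length true) := by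
  simp [coinQry, fstF, sndF]

/-- The adaptive bits of the coin reader are the coin string. [folklore] -/
theorem adBits_coinQry (A : Language Bool) (x : List Bool) :
    ∀ k : ℕ, adBits (coinQry q s p) A x k = ttBits id A (padFn q s p x) k
  | 0 => by simp [ttBits]
  | k + 1 => by
    rw [adBits_succ, ttBits_succ, adBits_coinQry A x k, coinQry_boolPair, length_ttBits]
    rfl

/-- **The coin reader is presented**: `x ↦ ⟨x, coinStr A x⟩` is an adaptive-query presentation
over `A`. [cite: LadnerLynchSelman1975, §3] -/
theorem adPres_coinFn (A : Language Bool) :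
    AdPres A (fun x => boolPair x (coinStr q s p A x)) :=
  ⟨coinQry q s p, fun w => w, PromiseAmp.coins p X, coinQry_mem_FP q s p, PolyTimeComputable.id _, fun x => by
    rw [adBits_coinQry]; rfl⟩

/-- **The solver is a `P^A` machine** (for every oracle `A`).
[cite: BookVollmerWagner1996, §4 Thm. 3 (p. 374)] -/
theorem dec_mem_PRel (hQ : Q ∈ FP) (hD : D ∈ Classes.P) (A : Language Bool) :
    dec Q q s D p A ∈ PRel (Oracle.ofLanguage A) := by
  have hamp : AdPres A (Oracle.ofLanguage (PromiseAmp.ampLang (adLang Q q D A) p X)) :=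
    adPres_ofLanguage_ampLang (adPres_ofLanguage_adLang hQ q hD) p X
  have h : AdPres A (Oracle.ofLanguage (PromiseAmp.ampLang (adLang Q q D A) p X) ∘
      fun x => boolPair x (coinStr q s p A x)) :=
    hamp.comp (adPres_coinFn q s p A)
  have he : Oracle.ofLanguage (dec Q q s D p A) =
      (Oracle.ofLanguage (PromiseAmp.ampLang (adLang Q q D A) p X) ∘
        fun x => boolPair x (coinStr q s p A x)) :=
    funext fun w => by
      rw [Function.comp_apply, ofLanguage_eq_singleton, ofLanguage_eq_singleton]
      exact congrArg (fun b => [b]) (boolIndicator_congr_of_iff Iff.rfl)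
  have hF : Oracle.ofLanguage (dec Q q s D p A) ∈ FPRel (Oracle.ofLanguage A) := by
    rw [he]; exact h.mem_FPRel
  exact OracleAlg.PRel_subset_PRel_of_mem_FPRel hF (self_mem_PRel_ofLanguage_holds _)

/-! ### Step 3a: locality — the votes only consult strings of length `≤ B(|x|)` -/

variable {Q s}

/-- Adaptive bits only depend on the oracle below the reach of the queries. [folklore] -/
theorem adBits_congr_oracle (hs : ∀ z, (Q z).length ≤ s.eval z.length) {A A' : Language Bool}
    (x : List Bool) {N : ℕ}
    (hAA' : ∀ u : List Bool, u.length ≤ s.eval (2 * x.length + 2 + N) → (u ∈ A ↔ u ∈ A')) :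
    ∀ i : ℕ, i ≤ N → adBits Q A x i = adBits Q A' x i
  | 0, _ => rfl
  | i + 1, hi => by
    have ih := adBits_congr_oracle hs x hAA' i (Nat.le_of_succ_le hi)
    rw [adBits_succ, adBits_succ, ih]
    congr 2
    refine boolIndicator_congr_of_iff (hAA' _ ((hs _).trans (TM2Iter.eval_mono s ?_)))
    rw [length_boolPair, length_adBits]
    omega

/-- Membership of `z` in the vote language only depends on the oracle on strings of length
`≤ s(2|z| + 2 + q|z|)`. [folklore] -/
theorem mem_adLang_congr (hs : ∀ z, (Q z).length ≤ s.eval z.length) {A A' : Language Bool}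
    (z : List Bool)
    (hAA' : ∀ u : List Bool, u.length ≤ s.eval (2 * z.length + 2 + q.eval z.length) →
      (u ∈ A ↔ u ∈ A')) :
    z ∈ adLang Q q D A ↔ z ∈ adLang Q q D A' := by
  rw [mem_adLang_iff, mem_adLang_iff, adBits_congr_oracle hs z hAA' _ le_rfl]

/-- The amplifier's verdict on `⟨x, c⟩` only depends on the votes `⟨x, u⟩`, `|u| ≤ p|x|`.
[cite: AroraBarak2009, §7.4.1] -/
theorem boolPair_mem_ampLang_congr {L₁ L₂ : Language Bool} {p' r : Polynomial ℕ} (x c : List Bool)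
    (h : ∀ u : List Bool, u.length ≤ p'.eval x.length → (boolPair x u ∈ L₁ ↔ boolPair x u ∈ L₂)) :
    boolPair x c ∈ PromiseAmp.ampLang L₁ p' r ↔ boolPair x c ∈ PromiseAmp.ampLang L₂ p' r := by
  have hy : ∀ i, PromiseAmp.yesCount L₁ p' x c i = PromiseAmp.yesCount L₂ p' x c i := fun i => by
    unfold PromiseAmp.yesCount
    congr 1
    exact Finset.filter_congr fun j _ => h _ (List.length_take_le _ _)
  rw [PromiseAmp.boolPair_mem_ampLang_iff, PromiseAmp.boolPair_mem_ampLang_iff, hy]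

/-- **Locality of the votes.** If `A` and `A'` agree on all strings of length `≤ B(|x|)` then the
votes `⟨x, u⟩`, `|u| ≤ p|x|`, agree. [folklore] -/
theorem votes_congr (hs : ∀ z, (Q z).length ≤ s.eval z.length) {A A' : Language Bool}
    (x : List Bool)
    (hAA' : ∀ u : List Bool, u.length ≤ (bnd q s p).eval x.length → (u ∈ A ↔ u ∈ A')) :
    ∀ u : List Bool, u.length ≤ p.eval x.length →
      (boolPair x u ∈ adLang Q q D A ↔ boolPair x u ∈ adLang Q q D A') := by
  intro u hu
  refine mem_adLang_congr q D hs _ fun w hw => hAA' w (hw.trans ?_)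
  rw [bnd_eval, length_boolPair]
  have h1 : 2 * x.length + 2 + u.length ≤ 2 * x.length + 2 + p.eval x.length := by omega
  have h2 := TM2Iter.eval_mono q h1
  exact TM2Iter.eval_mono s (by omega)

/-- **Locality of the error predicate** in the oracle below the reach bound. [folklore] -/
theorem errWith_congr (hs : ∀ z, (Q z).length ≤ s.eval z.length) {A A' : Language Bool}
    (x c : List Bool)
    (hAA' : ∀ u : List Bool, u.length ≤ (bnd q s p).eval x.length → (u ∈ A ↔ u ∈ A')) :
    errWith Q q D p A x c ↔ errWith Q q D p A' x c := by
  have hv := votes_congr q D p hs x hAA'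
  have hyes : x ∈ yesSet (adLang Q q D A) p ↔ x ∈ yesSet (adLang Q q D A') p := by
    show (2 : ℝ) / 3 ≤ uniformProb (p.eval x.length) {y : List Bool | boolPair x y ∈ adLang Q q D A} ↔
      (2 : ℝ) / 3 ≤ uniformProb (p.eval x.length) {y : List Bool | boolPair x y ∈ adLang Q q D A'}
    rw [uniformProb_congr (E := {y : List Bool | boolPair x y ∈ adLang Q q D A})
      (E' := {y : List Bool | boolPair x y ∈ adLang Q q D A'}) fun y hy => hv y hy.le]
  have hno : x ∈ noSet (adLang Q q D A) p ↔ x ∈ noSet (adLang Q q D A') p := by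
    show (2 : ℝ) / 3 ≤ uniformProb (p.eval x.length) {y : List Bool | boolPair x y ∉ adLang Q q D A} ↔
      (2 : ℝ) / 3 ≤ uniformProb (p.eval x.length) {y : List Bool | boolPair x y ∉ adLang Q q D A'}
    rw [uniformProb_congr (E := {y : List Bool | boolPair x y ∉ adLang Q q D A})
      (E' := {y : List Bool | boolPair x y ∉ adLang Q q D A'}) fun y hy => not_congr (hv y hy.le)]
  have hamp := boolPair_mem_ampLang_congr (r := X) x c hv
  simp only [errWith, hyes, hno, hamp]

/-! ### Step 3b: the error event of an input and its probability -/

/-- Coin strings agree when the oracles agree at the coin queries. [folklore] -/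
theorem ttBits_id_congr {A A' : Language Bool} (x' : List Bool) {k : ℕ}
    (h : ∀ i < k, (boolPair x' (List.replicate i true) ∈ A ↔ boolPair x' (List.replicate i true) ∈ A')) :
    ttBits id A x' k = ttBits id A' x' k := by
  unfold ttBits
  exact List.map_congr_left fun i hi => boolIndicator_congr_of_iff (h i (List.mem_range.1 hi))

/-- The error event is determined by the oracle bits of bounded length, hence measurable.
[folklore] -/
theorem measurableSet_errEvent (hs : ∀ z, (Q z).length ≤ s.eval z.length) (x : List Bool) :
    MeasurableSet (errEvent Q q s D p x) := by
  refine IsDetermined.measurableSet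
    (U := PromiseCook.shortStrings (2 * (padFn q s p x).length + 2 + (PromiseAmp.coins p X).eval x.length)) ?_
  intro A A' hAA'
  have hagree : ∀ u : List Bool,
      u.length ≤ 2 * (padFn q s p x).length + 2 + (PromiseAmp.coins p X).eval x.length →
      (u ∈ A ↔ u ∈ A') := fun u hu => by
    have h := congrFun hAA' ⟨u, PromiseCook.mem_shortStrings hu⟩
    rwa [Bool.eq_iff_iff, restrictBool_eq_true_iff, restrictBool_eq_true_iff] at h
  have hcoins : coinStr q s p A x = coinStr q s p A' x :=
    ttBits_id_congr _ fun i hi => hagree _ (by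
      rw [length_boolPair, List.length_replicate]; omega)
  show errWith Q q D p A x (coinStr q s p A x) ↔ errWith Q q D p A' x (coinStr q s p A' x)
  rw [← hcoins]
  refine errWith_congr q D p hs x _ fun u hu => hagree u (hu.trans ?_)
  have h0 := bnd_lt_length_window q s p x 0
  rw [length_boolPair, List.length_replicate] at h0
  omega

/-- **The coin window and its enumeration.** For a prefix `x'` and `m` coins there are a set `U`
of `m` strings with an enumeration `e : Fin m ≃ U`, `e i = ⟨x', 1ⁱ⟩`, such that for every
oracle the coin bits are the bits of `A` on `U` read through `e`. [folklore] -/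
theorem exists_window' (x' : List Bool) (m : ℕ) :
    ∃ (U : Finset (List Bool)) (e : Fin m ≃ U), U.card = m ∧
      (∀ i : Fin m, ((e i : U) : List Bool) = boolPair x' (List.replicate i true)) ∧
      ∀ A : Set (List Bool), ttBits id A x' m = List.ofFn fun i => restrictBool U A (e i) := by
  classical
  have hinj := BPPAlmostP.boolPair_replicate_injective x'
  obtain ⟨U, hmem, hcard⟩ : ∃ U : Finset (List Bool),
      (∀ u : List Bool, u ∈ U ↔ ∃ i : Fin m, boolPair x' (List.replicate i true) = u) ∧ U.card = m :=
    ⟨(Finset.univ : Finset (Fin m)).map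
      ⟨fun i : Fin m => boolPair x' (List.replicate i true), fun _ _ h => Fin.ext (hinj h)⟩,
      fun u => by simp, by simp⟩
  obtain ⟨e, he⟩ : ∃ e : Fin m ≃ U, ∀ i : Fin m,
      ((e i : U) : List Bool) = boolPair x' (List.replicate i true) :=
    ⟨{ toFun := fun i => ⟨boolPair x' (List.replicate i true), (hmem _).2 ⟨i, rfl⟩⟩
       invFun := fun u => ((hmem _).1 u.2).choose
       left_inv := fun i => Fin.ext (hinj ((hmem _).1 ((hmem _).2 ⟨i, rfl⟩)).choose_spec)
       right_inv := fun u => Subtype.ext ((hmem _).1 u.2).choose_spec }, fun _ => rfl⟩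
  refine ⟨U, e, hcard, he, fun A => List.ext_getElem (by simp) fun i h₁ h₂ => ?_⟩
  rw [getElem_ttBits A x' h₁, List.getElem_ofFn, ← BPPAlmostP.boolIndicator_eq_restrictBool, he]
  rfl

/-- Counting helper: a set of windows whose coin strings (read through `e`) lie in a set of
`uniformProb ≤ θ` has mass `≤ θ`. [cite: BookVollmerWagner1996, §3 Prop. 1–2 (p. 373–374)] -/
theorem card_windows_le {m : ℕ} {U : Finset (List Bool)} (e : Fin m ≃ U) (hcard : U.card = m)
    (S : Finset (U → Bool)) (E : Set (List Bool)) {θ : ℝ}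
    (hS : ∀ w ∈ S, (List.ofFn fun i => w (e i)) ∈ E) (hE : uniformProb m E ≤ θ) :
    ((S.card : ℝ≥0∞) * 2⁻¹ ^ U.card) ≤ ENNReal.ofReal θ := by
  classical
  rw [hcard]
  have hST : S.card ≤ (Finset.univ.filter fun g : Fin m → Bool => List.ofFn g ∈ E).card := by
    refine Finset.card_le_card_of_injOn (fun w => fun i => w (e i)) (fun w hw => ?_) ?_
    · simpa only [Finset.coe_filter, Finset.mem_univ, true_and, Set.mem_setOf_eq] using hS w hw
    · intro w₁ _ w₂ _ h
      funext u
      have := congrFun h (e.symm u)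
      simpa using this
  have hreal : (S.card : ℝ) / 2 ^ m ≤ θ := by
    refine le_trans ?_ hE
    rw [uniformProb_eq_card_fun]
    exact div_le_div_of_nonneg_right (by exact_mod_cast hST) (by positivity)
  have h2 : ((S.card : ℝ≥0∞) * 2⁻¹ ^ m) = ENNReal.ofReal ((S.card : ℝ) / 2 ^ m) := by
    rw [div_eq_mul_inv, ENNReal.ofReal_mul (Nat.cast_nonneg _), ENNReal.ofReal_natCast, ← inv_pow,
      ENNReal.ofReal_pow (by positivity), ENNReal.ofReal_inv_of_pos (by norm_num),
      ENNReal.ofReal_ofNat]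
  rw [h2]
  exact ENNReal.ofReal_le_ofReal hreal

/-- **The error probability on one input.** The solver violates the promise at `x` with
probability `≤ e^{-(|x|+1)}`: conditionally on the oracle below the reach bound (which fixes the
votes, the promise and the amplifier's verdict table) the coin bits are independent fair coins,
and the amplifier errs on at most an `e^{-(|x|+1)}` fraction of the coin strings.
[cite: BookVollmerWagner1996, §4 Thm. 3 (p. 374)] -/
theorem measure_errEvent_le (hs : ∀ z, (Q z).length ≤ s.eval z.length) (x : List Bool) :
    randomOracleMeasure (errEvent Q q s D p x) ≤ ENNReal.ofReal (Real.exp (-((x.length : ℝ) + 1))) := by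
  classical
  obtain ⟨U, e, hcard, he, hbits⟩ := exists_window' (padFn q s p x) ((PromiseAmp.coins p X).eval x.length)
  have hr : (((X : Polynomial ℕ).eval x.length : ℕ) : ℝ) = (x.length : ℝ) := by rw [eval_X]
  have hθ : ∀ A₀ : Set (List Bool),
      ((goodWindows (errEvent Q q s D p x) U A₀).card : ℝ≥0∞) * 2⁻¹ ^ U.card ≤
        ENNReal.ofReal (Real.exp (-((x.length : ℝ) + 1))) := by
    intro A₀
    -- off the window, the patched oracle is the background oracle
    have hagree : ∀ (w : U → Bool) (u : List Bool), u.length ≤ (bnd q s p).eval x.length →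
        (u ∈ patchFin A₀ U w ↔ u ∈ A₀) := fun w u hu => by
      refine mem_patchFin_of_not_mem w fun huU => ?_
      have h1 := he (e.symm ⟨u, huU⟩)
      rw [Equiv.apply_symm_apply] at h1
      have h2 := bnd_lt_length_window q s p x (e.symm ⟨u, huU⟩)
      rw [← h1] at h2
      exact absurd hu (not_le.2 h2)
    -- on the window, the coins of the patched oracle are the window bits
    have hcoinsw : ∀ w : U → Bool, coinStr q s p (patchFin A₀ U w) x = List.ofFn fun i => w (e i) :=
      fun w => by
        show ttBits id _ _ _ = _
        rw [hbits, restrictBool_patchFin]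
    have hgood : ∀ w : U → Bool, w ∈ goodWindows (errEvent Q q s D p x) U A₀ ↔
        errWith Q q D p A₀ x (List.ofFn fun i => w (e i)) := fun w => by
      rw [mem_goodWindows_iff]
      show errWith Q q D p _ x _ ↔ _
      rw [errWith_congr q D p hs x _ (hagree w), hcoinsw]
    by_cases hy : x ∈ yesSet (adLang Q q D A₀) p
    · have hn := not_mem_noSet_of_mem_yesSet hy
      refine card_windows_le e hcard _ {y | boolPair x y ∉ PromiseAmp.ampLang (adLang Q q D A₀) p X}
        (fun w hw => ?_) ?_
      · rcases (hgood w).1 hw with ⟨-, h⟩ | ⟨h, -⟩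
        · exact h
        · exact absurd h hn
      · have h := PromiseAmp.uniformProb_ampLang_compl_le_exp p X x hy
        rwa [hr] at h
    · by_cases hno : x ∈ noSet (adLang Q q D A₀) p
      · refine card_windows_le e hcard _ {y | boolPair x y ∈ PromiseAmp.ampLang (adLang Q q D A₀) p X}
          (fun w hw => ?_) ?_
        · rcases (hgood w).1 hw with ⟨h, -⟩ | ⟨-, h⟩
          · exact absurd h hy
          · exact h
        · have h := PromiseAmp.uniformProb_ampLang_le_exp p X x hno
          rwa [hr] at h
      · have h0 : goodWindows (errEvent Q q s D p x) U A₀ = ∅ :=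
          Finset.eq_empty_of_forall_notMem fun w hw => by
            rcases (hgood w).1 hw with ⟨h, -⟩ | ⟨h, -⟩
            · exact hy h
            · exact hno h
        rw [h0, Finset.card_empty, Nat.cast_zero, zero_mul]
        exact bot_le
  have h := measure_inter_le_of_window U (measurableSet_errEvent q D p hs x) MeasurableSet.univ
    (fun A => by simp) hθ
  rwa [Set.inter_univ, measure_univ, mul_one] at h

end Solver

/-! ### Step 4: union bound and Borel–Cantelli over the input lengths -/

/-- Union bound over the `2ⁿ` inputs of length `n`: `≤ 2ⁿ e^{-(n+1)} = e⁻¹ (2/e)ⁿ`. [folklore] -/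
theorem measure_iUnion_le (E : List Bool → Set (Set (List Bool)))
    (hE : ∀ x : List Bool, randomOracleMeasure (E x) ≤ ENNReal.ofReal (Real.exp (-((x.length : ℝ) + 1))))
    (n : ℕ) :
    randomOracleMeasure (⋃ v : List.Vector Bool n, E v.toList) ≤
      ENNReal.ofReal (Real.exp (-1)) * ENNReal.ofReal (2 * Real.exp (-1)) ^ n := by
  calc randomOracleMeasure (⋃ v : List.Vector Bool n, E v.toList)
      ≤ ∑ v : List.Vector Bool n, randomOracleMeasure (E v.toList) := measure_iUnion_fintype_le _ _
    _ ≤ ∑ _v : List.Vector Bool n, ENNReal.ofReal (Real.exp (-((n : ℝ) + 1))) :=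
        Finset.sum_le_sum fun v _ => by simpa only [List.Vector.toList_length] using hE v.toList
    _ = (2 : ℝ≥0∞) ^ n * ENNReal.ofReal (Real.exp (-((n : ℝ) + 1))) := by
        rw [Finset.sum_const, Finset.card_univ, card_vector, Fintype.card_bool, nsmul_eq_mul,
          Nat.cast_pow, Nat.cast_ofNat]
    _ = ENNReal.ofReal (Real.exp (-1)) * ENNReal.ofReal (2 * Real.exp (-1)) ^ n := by
        rw [← ENNReal.ofReal_pow (by positivity), mul_pow, ← ENNReal.ofReal_mul (Real.exp_nonneg _),
          ← Real.exp_nat_mul, ← ENNReal.ofReal_ofNat, ← ENNReal.ofReal_pow (by positivity),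
          ← ENNReal.ofReal_mul (by positivity)]
        congr 1
        rw [mul_left_comm, ← Real.exp_add]
        congr 2
        ring

/-- The error probabilities are summable over the input lengths:
`∑ₙ 2ⁿ e^{-(n+1)} ≤ e⁻¹ ∑ₙ (2/e)ⁿ < ∞`. [cite: BookVollmerWagner1996, §4 Thm. 3 (p. 374)] -/
theorem tsum_measure_iUnion_ne_top (E : List Bool → Set (Set (List Bool)))
    (hE : ∀ x : List Bool, randomOracleMeasure (E x) ≤ ENNReal.ofReal (Real.exp (-((x.length : ℝ) + 1)))) :
    ∑' n, randomOracleMeasure (⋃ v : List.Vector Bool n, E v.toList) ≠ ⊤ := by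
  have hratio : 2 * Real.exp (-1) < 1 := by
    have h2 : (2 : ℝ) < Real.exp 1 := by
      have := Real.add_one_lt_exp (one_ne_zero (α := ℝ))
      linarith
    rw [Real.exp_neg, ← div_eq_mul_inv, div_lt_one (Real.exp_pos 1)]
    exact h2
  refine ne_top_of_le_ne_top ?_ (ENNReal.tsum_le_tsum (measure_iUnion_le E hE))
  rw [ENNReal.tsum_mul_left, ENNReal.tsum_geometric]
  refine ENNReal.mul_ne_top ENNReal.ofReal_ne_top (ENNReal.inv_ne_top.2 ?_)
  exact (tsub_pos_iff_lt.2 (ENNReal.ofReal_lt_one.2 hratio)).ne'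

/-- **Borel–Cantelli.** If each error event `E x` has probability `≤ e^{-(|x|+1)}`, then almost
every oracle lies in no `E x` with `|x| ≥ n₀(A)`.
[cite: BookVollmerWagner1996, §4 Thm. 3 (p. 374)] -/
theorem ae_eventually_not_mem (E : List Bool → Set (Set (List Bool)))
    (hE : ∀ x : List Bool, randomOracleMeasure (E x) ≤ ENNReal.ofReal (Real.exp (-((x.length : ℝ) + 1)))) :
    ∀ᵐ (A : Set (List Bool)) ∂randomOracleMeasure, ∃ n₀ : ℕ, ∀ x : List Bool, n₀ ≤ x.length → A ∉ E x := by
  filter_upwards [ae_eventually_notMem (tsum_measure_iUnion_ne_top E hE)] with A hA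
  obtain ⟨n₀, hn₀⟩ := Filter.eventually_atTop.1 hA
  refine ⟨n₀, fun x hx => ?_⟩
  have h := hn₀ x.length hx
  simp only [Set.mem_iUnion, not_exists] at h
  exact h ⟨x, rfl⟩

/-! ### Step 5: patching and assembly -/

/-- **One index, almost every oracle.** For queries `Q ∈ FP` (output bound `s`), budget `q`,
evaluator `D ∈ P` and coin polynomial `p`: for almost every `A` the canonical problem of the
vote language `adLang Q q D A` has a solution in `P^A` — the solver `dec`, patched below the
Borel–Cantelli threshold `n₀(A)`. [cite: BookVollmerWagner1996, §4 Thm. 3 with (1) (p. 374–375)] -/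
theorem ae_canon_mem_promiseLift {Q : List Bool → List Bool} (hQ : Q ∈ FP) {s : Polynomial ℕ}
    (hs : ∀ z, (Q z).length ≤ s.eval z.length) (q : Polynomial ℕ) {D : Language Bool}
    (hD : D ∈ Classes.P) (p : Polynomial ℕ) :
    ∀ᵐ (A : Set (List Bool)) ∂randomOracleMeasure,
      canon (adLang Q q D A) p ∈ promiseLift (PRel (Oracle.ofLanguage A)) := by
  filter_upwards [ae_eventually_not_mem _ (measure_errEvent_le q D p hs)] with A ⟨n₀, hn₀⟩
  refine ⟨{x | (x.length < n₀ ∧ x ∈ yesSet (adLang Q q D A) p) ∨ (n₀ ≤ x.length ∧ x ∈ dec Q q s D p A)},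
    ?_, ?_, ?_⟩
  · refine mem_PRel_of_eqOn_le (dec_mem_PRel Q q s D p hQ hD A) n₀ fun x hx => ?_
    change (x.length < n₀ ∧ x ∈ yesSet (adLang Q q D A) p) ∨ (n₀ ≤ x.length ∧ x ∈ dec Q q s D p A) ↔
      x ∈ dec Q q s D p A
    constructor
    · rintro (⟨h, -⟩ | ⟨-, h⟩)
      · exact absurd hx (not_le.2 h)
      · exact h
    · exact fun h => Or.inr ⟨hx, h⟩
  · intro x hx
    by_cases hlt : x.length < n₀
    · exact Or.inl ⟨hlt, hx⟩
    · refine Or.inr ⟨not_lt.1 hlt, ?_⟩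
      by_contra hd
      exact hn₀ x (not_lt.1 hlt) ((mem_errEvent_iff Q q s D p).2 (Or.inl ⟨hx, hd⟩))
  · intro x hx hS
    rcases hS with ⟨-, hy⟩ | ⟨hle, hd⟩
    · exact not_mem_noSet_of_mem_yesSet hy hx
    · exact hn₀ x hle ((mem_errEvent_iff Q q s D p).2 (Or.inr ⟨hx, hd⟩))

end PromiseAlmostP

open PromiseAlmostP in
/-- **Bennett–Gill for promise problems.** Relative to a random oracle `A`, with probability `1`,
every promise problem of `promise-BPP^A` (`PromiseBPP'Rel`) has a solution language in `P^A`: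
`PromiseBPP'Rel (Oracle.ofLanguage A) ⊆ promiseLift (PRel (Oracle.ofLanguage A))` for almost
every `A`. (Countably many canonical problems — one per poly-time oracle machine in adaptive
normal form, budget and coin polynomial — each solved almost surely; every other problem is a
sub-problem of one of them.)
[cite: BennettGill1981, Thm. 5; BookVollmerWagner1996, §4 Thm. 3 with (1) (p. 374–375)] -/
theorem promiseBPP'Rel_subset_promiseLift_PRel_ae :
    ∀ᵐ (A : Set (List Bool)) ∂randomOracleMeasure,
      PromiseBPP'Rel (Oracle.ofLanguage A) ⊆ promiseLift (PRel (Oracle.ofLanguage A)) := by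
  haveI : Countable (Polynomial ℕ) := countable_polynomial_nat
  haveI : Countable {M : OracleAlg Bool // M.IsPolyTime encodingBoolBool} :=
    (countable_setOf_isPolyTime encodingBoolBool).to_subtype
  have hall : ∀ i : {M : OracleAlg Bool // M.IsPolyTime encodingBoolBool} × Polynomial ℕ × Polynomial ℕ,
      ∀ᵐ (A : Set (List Bool)) ∂randomOracleMeasure,
        canon (adLang (qryFn i.1.1) i.2.1 (haltLang i.1.1) A) i.2.2 ∈
          promiseLift (PRel (Oracle.ofLanguage A)) := by
    rintro ⟨⟨M, hM⟩, q, p⟩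
    obtain ⟨s, hs⟩ := exists_poly_length_le_of_mem_FP (qryFn_mem_FP hM)
    exact ae_canon_mem_promiseLift (qryFn_mem_FP hM) hs q (haltLang_mem_P hM) p
  filter_upwards [ae_all_iff.2 hall] with A hA
  intro T hT
  obtain ⟨W, hW, p, hyes, hno⟩ := exists_canon_of_mem hT
  obtain ⟨M, hM, q, hq⟩ := hW
  have hWeq : W = adLang (qryFn M) q (haltLang M) A := eq_adLang_of_run fun w => (hq w).1
  have h : canon (adLang (qryFn M) q (haltLang M) A) p ∈ promiseLift (PRel (Oracle.ofLanguage A)) :=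
    hA ⟨⟨M, hM⟩, q, p⟩
  rw [← hWeq] at h
  exact mem_promiseLift_of_subset hyes hno h

open PromiseAlmostP in
/-- **Corollary.** Relative to a random oracle, with probability `1`, every promise problem of
`promise-BPP^A` has a solution language in `BPP^A` (`PRel ⊆ BPPRel`).
[cite: BennettGill1981, Thm. 5] -/
theorem promiseBPP'Rel_subset_promiseLift_BPPRel_ae :
    ∀ᵐ (A : Set (List Bool)) ∂randomOracleMeasure,
      PromiseBPP'Rel (Oracle.ofLanguage A) ⊆ promiseLift (BPPRel (Oracle.ofLanguage A)) := by
  filter_upwards [promiseBPP'Rel_subset_promiseLift_PRel_ae] with A hA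
  exact hA.trans (promiseLift_mono (PRel_subset_BPPRel_holds _))

end Literature.Computability.Complexity
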